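import Summits.QuantumFields.YangMills.Theorems.FluctuationComparisonRegPrIntLS1aDomBGOfHistoryLetters
import HarnessLib

/-!
# S1a · THE PER-HISTORY LETTERS IN PRINT's OWN CURRENCY: a history's RESTRICTED RENORMALISED DENSITY `ρ^{E_S}_{K−j}(V)` at most `Π_{i∈S} ω_i` times the
# ALL-SMALL-HISTORY density `ρ^{E_∅}_{K−j}(V)` at almost every good datum `V` — (41)'s history term against its all-small term, POINTWISE IN THE BOTTOM DATUM —
# gives the measure-level letters of ✓`…S1aDomBGOfHistoryLetters`, hence `hdomBG_j`

Cell `ym3-torus` (YM ladder rung R3 = continuum `SU(2)` Yang–Mills on the three-torus — a RUNG: NOT d = 4, NOT infinite volume, NOT a mass gap, NOT Clay).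
Width seat «width 8» `ym3-torus-px8` (gen 27), FREE px helper on crux `stmt-QuantumFields-20520`, count-neutral, DEFINITION-FREE, default heartbeats.  FILE 2 of the seat
(FILE 1 ✓`…S1aDomBGOfHistoryLetters`: print's (7)→(41) history expansion on the cut tower by kernel, `hdomBG_j` ⟸ per-history relative letters at MEASURE level).

WHY.  FILE 1's letter for a history `S ⊆ [j, Ts)` compares two Gibbs INTEGRALS of `[0,1]`-valued weights above an arbitrary measurable `A ⊆ D_j`.  Print's (41) p.266 compares
DENSITIES at the bottom datum: `ρ_k(V) ≤ Σ_{histories} (history term)(V)`, each term an `E`-restricted fibre integral above `V`.  The tree already names that object: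
lit `T3TiltDescent.heightDensity F γ hjK E` = `ρ^{E}_{K−j}`, Bałaban's `T_{K−j−1}⋯T_0(1_E e^{−β_K A})` read at height `j`, with the push-forward identity
✓`map_descendTo_restrict_eq_withDensity` (`(descendTo_j)_*(Gibbs_K|E) = dU_j · Z_K⁻¹ρ^{E}_{K−j}`).  THIS FILE moves FILE 1's letters into that currency: (i) a history's soft weight
`Π_{i∈S}(1 − w i)·Π_{i∉S} w i` is dominated by the indicator of its LARGE∕SUPPORT EVENT `E_S` («off the plateau `Tg_{i+1}` at the cut steps of `S`, inside the support window
`Sp_{i+1}` at the others» — print's `P_j ⊂ Λ_j`, `Z_j`, (38)–(40) p.266) and the all-small weight dominates the indicator of the PLATEAU EVENT `E₁`; (ii) hence ONE inequality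
«`ρ^{E_S}_{K−j}(V) ≤ (Π_{i∈S} ω_i) · ρ^{E₁}_{K−j}(V)` for `dU_j`-a.e. `V ∈ D_j`» — (41)'s TERM OF THE HISTORY `S` AGAINST ITS ALL-SMALL TERM, POINTWISE IN THE BOTTOM DATUM — gives
FILE 1's letter for `S`, hence (FILE 1) `ν K j ≤ e^{Σω}·μ j` on `D_j` and the `hdomBG_j` binder of the tower door of record.

WHAT (0 `def`, 0 `sorry`).
§0 `prod_tsub_mul_prod_le_indicator` ∕ `indicator_le_prod_of_eq_one` — pointwise: history weight `≤ 1_{E_S}`, `1_{E₁} ≤` all-small weight [folklore].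
§1 ★★`historyLetter_of_restrictedMass` — any measure space: `G(B ∩ E_S) ≤ c·G(B ∩ E₁)` ⟹ FILE 1's letter for `S` above `B` with constant `c` [folklore].
§2 `measurableSet_histEvent` ∕ `measurableSet_plateauEvent` — the two events of run `K` (quantified over the proofs `i + 1 ≤ K`, as ✓p832521's targets) are measurable;
   ★★★`historyLetter_of_heightDensityLetter` — AT THE T³ RUNS: «`ρ^{E_S}_{K−j} ≤ c·ρ^{E₁}_{K−j}` a.e. on `D`» ⟹ FILE 1's letter for `S` above every measurable `A ⊆ D`
   (`Z_K⁻¹` cancels; lit ✓`map_descendTo_restrict_eq_withDensity`).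
§3 ★★★`run_le_exp_mul_cutTower_of_heightDensityLetters` ∕ ★★★`hdomBG_of_heightDensityLetters` — the composition with FILE 1 at the canonical weights
   `w i = ofReal ∘ χ_{i+1} ∘ descendTo_{i+1}` (✓`canonicalWeight_spec`), for real cut weights `χ ≤ 1` equal to `1` on `Tg_i` (`hplat`, the door's plateau clause) and `≤ 0` off
   `Sp_i` (`hsupp`): the density letters for every nonempty `S ⊆ [j, Ts)` with `Σ_{[j,Ts)} ω ≤ Δ` ⟹ the `hdomBG_j` binder of ✓p831345 VERBATIM.
§4 `prod_ramp_eq_one_of_forall_one_le` ∕ `prod_ramp_nonpos_of_exists_nonpos` — any `sfCut`-shaped product of clipped ramps is `1` when all arguments are `≥ 1` and `≤ 0` when one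
   is `≤ 0` (the consumer's `hplat`∕`hsupp` one-liners for the line's `RunPairOrgan.sfCut θ`: `Tg = {∀ p, dist1 ≤ θ∕2}`, `Sp = {∀ p, dist1 < 24θ∕25}`).

★p1's RESIDUAL FOR THE (m)_E CUT HEIGHTS, IN PRINT's CURRENCY (UV3-NODE §69.20; nothing asserted): per nonempty history `S ⊆ [j, Ts)`,
«`ρ^{E_S}_{K−j}(V) ≤ (Π_{i∈S} ω_i) · ρ^{E₁}_{K−j}(V)` at (almost) every (E)-good datum `V` of height `j`», `Σ_{i≥j} ω_i ≤ Δ_j` — [Balaban1985UV3] (41) read RELATIVE to its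
all-small-field term.  Print's inputs per history: the small factor `e^{−¼p²(g)}` per large plaquette (67)–(71) p.273 (kernel on the torus for print's average: lit
✓`B10Eq71TorusLocal`); variational monotonicity of the all-small minimiser ((42) p.266); the RELATIVE volume cost `e^{O(log g⁻¹)|Z|}` of (41) — in print only as an ABSOLUTE
bound, relative to the all-small term it is the locality of the difference of two effective actions ([Balaban1985Variational] stability + [9] Sect. 3.C) and is NOT a printed
sentence; the resummation (FILE 1 §0, kernel).  HONEST: measure-theoretic bookkeeping over landed kernel facts; every `ω_i` and every density letter is a HYPOTHESIS; `hdomBG_j`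
REDUCED, NOT discharged; nothing of Bałaban's renormalisation-group analysis asserted or proved; (α) package UNINHABITED; (m) AS TYPED suspect-false@L=3 (RULING №105), (m)_E OPEN;
the five registered stubs (3732b7df UNTOUCHED, 0∕5) ∕ 20520 ∕ 19936 ∕ 19200 ∕ `YM3TorusSU2` NOT proved; rung R3 = SU(2) YM₃ on T³ at fixed lattice data — NOT d = 4, NOT infinite
volume, NOT a mass gap, NOT Clay.  Sorry-free, axioms standard.
References: [Balaban1985UV3] CMP 102 (1985) (2) p.256, (7) p.257, (38)–(42) p.266, (47) p.267, (67)–(71) pp.273–274; [Balaban1987RG1] CMP 109 (1987) (0.11) p.253.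
-/

set_option autoImplicit false

noncomputable section

namespace Summit.QuantumFields.YangMills.Theorems.FluctuationComparisonRegPrIntLS1aHistoryLettersOfRestrictedDensities

open MeasureTheory Filter Topology Set Function
open scoped ENNReal NNReal
open Literature.MathematicalPhysics.QuantumFieldTheory.Balaban1983to89
open T3ContinuumYM3Torus T3NestedUnitLaws T3UnitLawDensityEML T3UnitScaleTilt T3LevelShift T3TiltDescent T4Continuum BalabanUVClass
open Literature.MathematicalPhysics.QuantumFieldTheory.Balaban1983to89.Missing
open scoped Literature.MathematicalPhysics.QuantumFieldTheory.Balaban1983to89.T3OrbitAverage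
open Summit.QuantumFields.YangMills.Theorems.FluctuationComparisonRegPrIntLS1aDomBGOfHistoryLetters
  (run_le_exp_mul_cutTower_of_historyLetters hdomBG_of_historyLetters)

/-! ## §0 Pointwise: a history's weight is dominated by the indicator of its LARGE∕SUPPORT event; the all-small weight dominates the indicator of the PLATEAU event -/

section Pointwise

variable {X : Type*}

/-- If one factor of a finite product of weights `≤ 1` vanishes the product vanishes; otherwise it is `≤ 1`: for weights `g_i ≤ 1`,
`(Π_{i∈S} (1 − g_i x)) · (Π_{i∈I∖S} g_i x) ≤ 1_{E}(x)` for ANY set `E` containing every `x` with `g_i x ≠ 1` for all `i ∈ S` and `g_i x ≠ 0` for all `i ∈ I∖S`. [folklore] -/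
theorem prod_tsub_mul_prod_le_indicator (I S : Finset ℕ) {g : ℕ → X → ℝ≥0∞} (hg1 : ∀ i x, g i x ≤ 1) {E : Set X}
    (hE : ∀ x, (∀ i ∈ S, g i x ≠ 1) → (∀ i ∈ I \ S, g i x ≠ 0) → x ∈ E) (x : X) :
    (∏ i ∈ S, (1 - g i x)) * (∏ i ∈ I \ S, g i x) ≤ E.indicator 1 x := by
  by_cases hx : x ∈ E
  · rw [indicator_of_mem hx, Pi.one_apply]
    exact mul_le_one' (Finset.prod_le_one' fun i _ => tsub_le_self) (Finset.prod_le_one' fun i _ => hg1 i x)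
  · rw [indicator_of_notMem hx]
    -- some factor vanishes
    have h : ¬ ((∀ i ∈ S, g i x ≠ 1) ∧ (∀ i ∈ I \ S, g i x ≠ 0)) := fun h => hx (hE x h.1 h.2)
    rw [not_and_or] at h
    rcases h with h | h
    · push Not at h
      obtain ⟨i, hi, hgi⟩ := h
      have h0 : ∏ i ∈ S, (1 - g i x) = 0 := Finset.prod_eq_zero hi (by rw [hgi, tsub_self])
      rw [h0, zero_mul]
    · push Not at h
      obtain ⟨i, hi, hgi⟩ := h
      have h0 : ∏ i ∈ I \ S, g i x = 0 := Finset.prod_eq_zero hi hgi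
      rw [h0, mul_zero]

/-- The all-small weight dominates the indicator of any set on which every weight equals one: `1_{E}(x) ≤ Π_{i∈I} g_i x` if `g_i = 1` on `E` for `i ∈ I`. [folklore] -/
theorem indicator_le_prod_of_eq_one (I : Finset ℕ) {g : ℕ → X → ℝ≥0∞} {E : Set X} (hE : ∀ x ∈ E, ∀ i ∈ I, g i x = 1) (x : X) :
    E.indicator 1 x ≤ ∏ i ∈ I, g i x := by
  by_cases hx : x ∈ E
  · rw [indicator_of_mem hx, Pi.one_apply, Finset.prod_eq_one fun i hi => hE x hx i hi]
  · rw [indicator_of_notMem hx]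
    exact bot_le

end Pointwise

/-! ## §1 Measure currency: the per-history letter from ONE inequality between restricted Gibbs masses -/

section Measure

variable {X : Type*} [MeasurableSpace X]

/-- ★★ **THE PER-HISTORY LETTER FROM RESTRICTED MASSES.**  On a measure space `(X, G)` with weights `g_i ≤ 1`, a «base» set `B`, a history `S ⊆ I`, a LARGE∕SUPPORT event `E_S`
(containing every point where the factors of the history's weight are all non-zero) and a PLATEAU event `E₁` (on which every `g_i`, `i ∈ I`, equals `1`), measurable:
`G (B ∩ E_S) ≤ c · G (B ∩ E₁)` ⟹ `∫⁻_B Π_S(1 − g)·Π_{I∖S} g dG ≤ c · ∫⁻_B Π_I g dG` — the letter of ✓`…S1aDomBGOfHistoryLetters` for `S`. [cite: Balaban1985UV3, (7) p.257 and (41) p.266] -/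
theorem historyLetter_of_restrictedMass (G : Measure X) (I S : Finset ℕ) {g : ℕ → X → ℝ≥0∞} (hg1 : ∀ i x, g i x ≤ 1)
    {B E ES : Set X} (hB : MeasurableSet B) (hEm : MeasurableSet E) (hESm : MeasurableSet ES)
    (hES : ∀ x, (∀ i ∈ S, g i x ≠ 1) → (∀ i ∈ I \ S, g i x ≠ 0) → x ∈ ES) (hE : ∀ x ∈ E, ∀ i ∈ I, g i x = 1)
    {c : ℝ≥0∞} (h : G (B ∩ ES) ≤ c * G (B ∩ E)) :
    ∫⁻ x in B, (∏ i ∈ S, (1 - g i x)) * (∏ i ∈ I \ S, g i x) ∂G ≤ c * ∫⁻ x in B, ∏ i ∈ I, g i x ∂G := by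
  calc ∫⁻ x in B, (∏ i ∈ S, (1 - g i x)) * (∏ i ∈ I \ S, g i x) ∂G
      ≤ ∫⁻ x in B, ES.indicator 1 x ∂G := setLIntegral_mono' hB fun x _ => prod_tsub_mul_prod_le_indicator I S hg1 hES x
    _ = G (B ∩ ES) := by rw [lintegral_indicator_one hESm, Measure.restrict_apply hESm, inter_comm]
    _ ≤ c * G (B ∩ E) := h
    _ = c * ∫⁻ x in B, E.indicator 1 x ∂G := by rw [lintegral_indicator_one hEm, Measure.restrict_apply hEm, inter_comm]
    _ ≤ c * ∫⁻ x in B, ∏ i ∈ I, g i x ∂G := by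
        gcongr with x
        exact indicator_le_prod_of_eq_one I hE x

end Measure

/-! ## §2 At the T³ runs: the history events of run `K`, and the letters in the currency of print's RESTRICTED RENORMALISED DENSITIES `ρ^{E}_{K−j}` -/

section Runs

variable (F : T3Family) {γ : ℝ} {K Ts j : ℕ} (hTs : Ts ≤ K) (hjK : j ≤ K)
  -- the supplier's per-height PLATEAU targets `Tg` (where the cut weight is `1`) and SUPPORT windows `Sp` (off which it is `0`), at the cut heights `i+1`, `i ∈ [j, Ts)`
  (Tg Sp : (i : ℕ) → Set (GaugeField (F.P i) 0 ↥(Matrix.specialUnitaryGroup (Fin 2) ℂ)))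

/-- The LARGE∕SUPPORT event of the history `S` on run `K`'s finest fields — «off the plateau `Tg_{i+1}` at every cut step `i ∈ S`, inside the support window `Sp_{i+1}` at every other
cut step of `[j, Ts)`» — is measurable (targets and windows measurable; lit ✓`measurable_descendTo`). [cite: Balaban1985UV3, (7) p.257 and (40) p.266] -/
theorem measurableSet_histEvent (hTgm : ∀ i, MeasurableSet (Tg i)) (hSpm : ∀ i, MeasurableSet (Sp i)) (S : Finset ℕ) :
    MeasurableSet {U : GaugeField (F.P K) 0 ↥(Matrix.specialUnitaryGroup (Fin 2) ℂ) |
      (∀ i ∈ S, ∀ (h : i + 1 ≤ K), descendTo F ℰp (i + 1) K h U ∉ Tg (i + 1)) ∧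
      (∀ i ∈ Finset.Ico j Ts, i ∉ S → ∀ (h : i + 1 ≤ K), descendTo F ℰp (i + 1) K h U ∈ Sp (i + 1))} := by
  have hpre : ∀ (i : ℕ) (T : Set (GaugeField (F.P (i + 1)) 0 ↥(Matrix.specialUnitaryGroup (Fin 2) ℂ))), MeasurableSet T →
      MeasurableSet {U : GaugeField (F.P K) 0 ↥(Matrix.specialUnitaryGroup (Fin 2) ℂ) | ∀ (h : i + 1 ≤ K), descendTo F ℰp (i + 1) K h U ∈ T} := by
    intro i T hT
    by_cases h : i + 1 ≤ K
    · have e : {U : GaugeField (F.P K) 0 ↥(Matrix.specialUnitaryGroup (Fin 2) ℂ) | ∀ (h : i + 1 ≤ K), descendTo F ℰp (i + 1) K h U ∈ T} =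
          descendTo F ℰp (i + 1) K h ⁻¹' T := by
        ext U; exact ⟨fun hU => hU h, fun hU _ => hU⟩
      rw [e]
      exact measurable_descendTo F ℰp measurableE_ℰp h hT
    · have e : {U : GaugeField (F.P K) 0 ↥(Matrix.specialUnitaryGroup (Fin 2) ℂ) | ∀ (h : i + 1 ≤ K), descendTo F ℰp (i + 1) K h U ∈ T} = univ := by
        ext U
        simp only [mem_setOf_eq, mem_univ, iff_true]
        exact fun h' => (h h').elim
      rw [e]
      exact MeasurableSet.univ
  have h1 : MeasurableSet {U : GaugeField (F.P K) 0 ↥(Matrix.specialUnitaryGroup (Fin 2) ℂ) |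
      ∀ i ∈ S, ∀ (h : i + 1 ≤ K), descendTo F ℰp (i + 1) K h U ∉ Tg (i + 1)} := by
    have e : {U : GaugeField (F.P K) 0 ↥(Matrix.specialUnitaryGroup (Fin 2) ℂ) | ∀ i ∈ S, ∀ (h : i + 1 ≤ K), descendTo F ℰp (i + 1) K h U ∉ Tg (i + 1)} =
        ⋂ i ∈ S, {U | ∀ (h : i + 1 ≤ K), descendTo F ℰp (i + 1) K h U ∈ (Tg (i + 1))ᶜ} := by
      ext U; simp
    rw [e]
    exact MeasurableSet.biInter (Finset.countable_toSet S) fun i _ => hpre i _ (hTgm (i + 1)).compl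
  have h2 : MeasurableSet {U : GaugeField (F.P K) 0 ↥(Matrix.specialUnitaryGroup (Fin 2) ℂ) |
      ∀ i ∈ Finset.Ico j Ts, i ∉ S → ∀ (h : i + 1 ≤ K), descendTo F ℰp (i + 1) K h U ∈ Sp (i + 1)} := by
    have e : {U : GaugeField (F.P K) 0 ↥(Matrix.specialUnitaryGroup (Fin 2) ℂ) |
          ∀ i ∈ Finset.Ico j Ts, i ∉ S → ∀ (h : i + 1 ≤ K), descendTo F ℰp (i + 1) K h U ∈ Sp (i + 1)} =
        ⋂ i ∈ Finset.Ico j Ts, {U | i ∉ S → ∀ (h : i + 1 ≤ K), descendTo F ℰp (i + 1) K h U ∈ Sp (i + 1)} := by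
      ext U; simp
    rw [e]
    refine MeasurableSet.biInter (Finset.countable_toSet _) fun i _ => ?_
    by_cases hiS : i ∈ S
    · have e' : {U : GaugeField (F.P K) 0 ↥(Matrix.specialUnitaryGroup (Fin 2) ℂ) | i ∉ S → ∀ (h : i + 1 ≤ K), descendTo F ℰp (i + 1) K h U ∈ Sp (i + 1)} = univ := by
        ext U
        simp only [mem_setOf_eq, mem_univ, iff_true]
        exact fun h' => (h' hiS).elim
      rw [e']; exact MeasurableSet.univ
    · have e' : {U : GaugeField (F.P K) 0 ↥(Matrix.specialUnitaryGroup (Fin 2) ℂ) | i ∉ S → ∀ (h : i + 1 ≤ K), descendTo F ℰp (i + 1) K h U ∈ Sp (i + 1)} =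
          {U | ∀ (h : i + 1 ≤ K), descendTo F ℰp (i + 1) K h U ∈ Sp (i + 1)} := by
        ext U
        simp only [mem_setOf_eq]
        exact ⟨fun hU h => hU hiS h, fun hU _ h => hU h⟩
      rw [e']; exact hpre i _ (hSpm (i + 1))
  exact h1.inter h2

/-- The PLATEAU event «on the plateau `Tg_{i+1}` at every cut step `i ∈ [j, Ts)`» (the history `S = ∅` read with `Sp := Tg`) is measurable. [cite: Balaban1985UV3, (7) p.257] -/
theorem measurableSet_plateauEvent (hTgm : ∀ i, MeasurableSet (Tg i)) :
    MeasurableSet {U : GaugeField (F.P K) 0 ↥(Matrix.specialUnitaryGroup (Fin 2) ℂ) |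
      ∀ i ∈ Finset.Ico j Ts, ∀ (h : i + 1 ≤ K), descendTo F ℰp (i + 1) K h U ∈ Tg (i + 1)} := by
  have h := measurableSet_histEvent F Tg Tg (K := K) (Ts := Ts) (j := j) hTgm hTgm ∅
  have e : {U : GaugeField (F.P K) 0 ↥(Matrix.specialUnitaryGroup (Fin 2) ℂ) |
      (∀ i ∈ (∅ : Finset ℕ), ∀ (h : i + 1 ≤ K), descendTo F ℰp (i + 1) K h U ∉ Tg (i + 1)) ∧
      (∀ i ∈ Finset.Ico j Ts, i ∉ (∅ : Finset ℕ) → ∀ (h : i + 1 ≤ K), descendTo F ℰp (i + 1) K h U ∈ Tg (i + 1))} =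
      {U | ∀ i ∈ Finset.Ico j Ts, ∀ (h : i + 1 ≤ K), descendTo F ℰp (i + 1) K h U ∈ Tg (i + 1)} := by
    ext U
    simp only [Finset.notMem_empty, false_imp_iff, implies_true, true_and, not_false_eq_true, forall_true_left, mem_setOf_eq]
  rw [← e]
  exact h


variable (hTgm : ∀ i, MeasurableSet (Tg i)) (hSpm : ∀ i, MeasurableSet (Sp i)) (hγ : 0 ≤ γ)

include hTs hTgm hSpm hγ in
/-- ★★★ **THE PER-HISTORY LETTER FROM A LETTER ON PRINT's RESTRICTED RENORMALISED DENSITIES.**  Run `K`, bottom height `j ≤ K`, cut steps `[j, Ts)` (`Ts ≤ K`); per-height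
plateau targets `Tg` and support windows `Sp`; a weight family `w ≤ 1` on run `K`'s finest fields with `w i = 1` where the `(i+1)`-th descended field is on `Tg_{i+1}` and `w i = 0`
where it is off `Sp_{i+1}` (the line's `ofReal ∘ sfCut ∘ descendTo`: plateau `{PlaqSmall (θ∕2)}`, window `{PlaqSmall (24θ∕25)}`); a history `S ⊆ [j, Ts)` with its LARGE∕SUPPORT
event `E_S` and the PLATEAU event `E₁` of run `K` (§2).  IF for `dU_j`-almost every datum `V ∈ D`
«`ρ^{E_S}_{K−j}(V) ≤ c · ρ^{E₁}_{K−j}(V)`» (lit `T3TiltDescent.heightDensity F γ hjK E` = Bałaban's `E`-RESTRICTED renormalised density of run `K` read at height `j` —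
(41)'s term of the history `S` against its all-small term, POINTWISE IN THE BOTTOM DATUM, print's own currency `ρ_k(V)`), THEN for every measurable `A ⊆ D` the measure-level
letter of ✓`…S1aDomBGOfHistoryLetters` holds for `S` with constant `c`:
`∫⁻_{descendTo_j⁻¹A} Π_{i∈S}(1 − w i)·Π_{i∈[j,Ts)∖S} w i dGibbs_K ≤ c · ∫⁻_{descendTo_j⁻¹A} Π_{[j,Ts)} w i dGibbs_K` (§1 + lit ✓`map_descendTo_restrict_eq_withDensity`, `Z_K⁻¹`
cancels).  Nothing of Bałaban's asserted; the density letter is the HYPOTHESIS. [cite: Balaban1985UV3, (2) p.256, (7) p.257, (41) p.266 and (47) p.267] -/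
theorem historyLetter_of_heightDensityLetter (S : Finset ℕ) (hS : S ⊆ Finset.Ico j Ts)
    {w : ℕ → GaugeField (F.P K) 0 ↥(Matrix.specialUnitaryGroup (Fin 2) ℂ) → ℝ≥0∞} (hw1 : ∀ i U, w i U ≤ 1)
    (hwTg : ∀ i ∈ Finset.Ico j Ts, ∀ (h : i + 1 ≤ K) (U : GaugeField (F.P K) 0 ↥(Matrix.specialUnitaryGroup (Fin 2) ℂ)),
      descendTo F ℰp (i + 1) K h U ∈ Tg (i + 1) → w i U = 1)
    (hwSp : ∀ i ∈ Finset.Ico j Ts, ∀ (h : i + 1 ≤ K) (U : GaugeField (F.P K) 0 ↥(Matrix.specialUnitaryGroup (Fin 2) ℂ)),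
      w i U ≠ 0 → descendTo F ℰp (i + 1) K h U ∈ Sp (i + 1))
    {c : ℝ} (hc : 0 ≤ c) {D : Set (GaugeField (F.P j) 0 ↥(Matrix.specialUnitaryGroup (Fin 2) ℂ))}
    (hdens : ∀ᵐ V ∂(fieldMeasure (F.P j) 0 ↥(Matrix.specialUnitaryGroup (Fin 2) ℂ)), V ∈ D →
      heightDensity F γ hjK {U : GaugeField (F.P K) 0 ↥(Matrix.specialUnitaryGroup (Fin 2) ℂ) |
          (∀ i ∈ S, ∀ (h : i + 1 ≤ K), descendTo F ℰp (i + 1) K h U ∉ Tg (i + 1)) ∧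
          (∀ i ∈ Finset.Ico j Ts, i ∉ S → ∀ (h : i + 1 ≤ K), descendTo F ℰp (i + 1) K h U ∈ Sp (i + 1))} V ≤
        c * heightDensity F γ hjK {U : GaugeField (F.P K) 0 ↥(Matrix.specialUnitaryGroup (Fin 2) ℂ) |
          ∀ i ∈ Finset.Ico j Ts, ∀ (h : i + 1 ≤ K), descendTo F ℰp (i + 1) K h U ∈ Tg (i + 1)} V)
    {A : Set (GaugeField (F.P j) 0 ↥(Matrix.specialUnitaryGroup (Fin 2) ℂ))} (hA : MeasurableSet A) (hAD : A ⊆ D) :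
    ∫⁻ U in descendTo F ℰp j K hjK ⁻¹' A, (∏ i ∈ S, (1 - w i U)) * (∏ i ∈ Finset.Ico j Ts \ S, w i U) ∂(gibbsK F ℰp γ K) ≤
      ENNReal.ofReal c * ∫⁻ U in descendTo F ℰp j K hjK ⁻¹' A, ∏ i ∈ Finset.Ico j Ts, w i U ∂(gibbsK F ℰp γ K) := by
  -- names for the two events
  set ES := {U : GaugeField (F.P K) 0 ↥(Matrix.specialUnitaryGroup (Fin 2) ℂ) |
      (∀ i ∈ S, ∀ (h : i + 1 ≤ K), descendTo F ℰp (i + 1) K h U ∉ Tg (i + 1)) ∧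
      (∀ i ∈ Finset.Ico j Ts, i ∉ S → ∀ (h : i + 1 ≤ K), descendTo F ℰp (i + 1) K h U ∈ Sp (i + 1))} with hES
  set E₁ := {U : GaugeField (F.P K) 0 ↥(Matrix.specialUnitaryGroup (Fin 2) ℂ) |
      ∀ i ∈ Finset.Ico j Ts, ∀ (h : i + 1 ≤ K), descendTo F ℰp (i + 1) K h U ∈ Tg (i + 1)} with hE₁
  have hESm : MeasurableSet ES := measurableSet_histEvent F Tg Sp hTgm hSpm S
  have hE₁m : MeasurableSet E₁ := measurableSet_plateauEvent F Tg hTgm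
  have hD : Measurable (descendTo F ℰp j K hjK : GaugeField (F.P K) 0 ↥(Matrix.specialUnitaryGroup (Fin 2) ℂ) →
      GaugeField (F.P j) 0 ↥(Matrix.specialUnitaryGroup (Fin 2) ℂ)) := measurable_descendTo F ℰp measurableE_ℰp hjK
  refine historyLetter_of_restrictedMass (gibbsK F ℰp γ K) (Finset.Ico j Ts) S hw1 (hA.preimage hD) hE₁m hESm ?_ ?_ ?_
  · -- a point where all the history's factors are non-trivial lies in its LARGE∕SUPPORT event
    intro U h1 h0
    refine ⟨fun i hi h hT => h1 i hi (hwTg i (hS hi) h U hT), fun i hi hiS h => hwSp i hi h U (h0 i (Finset.mem_sdiff.mpr ⟨hi, hiS⟩))⟩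
  · -- on the PLATEAU event every weight is one
    intro U hU i hi
    have hiK : i + 1 ≤ K := Nat.succ_le_of_lt (lt_of_lt_of_le (Finset.mem_Ico.mp hi).2 hTs)
    exact hwTg i hi hiK U (hU i hi hiK)
  · -- the restricted Gibbs masses in the density currency
    have hZ : 0 < partitionFn (G := ↥(Matrix.specialUnitaryGroup (Fin 2) ℂ)) (F.P K) ((F.scheme ℰp γ).β K) :=
      partitionFn_pos' _ (F.scheme_β_nonneg ℰp hγ K)
    have key : ∀ (E : Set (GaugeField (F.P K) 0 ↥(Matrix.specialUnitaryGroup (Fin 2) ℂ))), MeasurableSet E →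
        gibbsK F ℰp γ K (descendTo F ℰp j K hjK ⁻¹' A ∩ E) =
          ∫⁻ V in A, ENNReal.ofReal ((partitionFn (G := ↥(Matrix.specialUnitaryGroup (Fin 2) ℂ)) (F.P K) ((F.scheme ℰp γ).β K))⁻¹ *
            heightDensity F γ hjK E V) ∂(fieldMeasure (F.P j) 0 ↥(Matrix.specialUnitaryGroup (Fin 2) ℂ)) := by
      intro E hE
      rw [← Measure.restrict_apply' hE, ← Measure.map_apply hD hA, map_descendTo_restrict_eq_withDensity F hjK hE hγ, withDensity_apply _ hA]
    rw [key ES hESm, key E₁ hE₁m, ← lintegral_const_mul' _ _ ENNReal.ofReal_ne_top]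
    refine setLIntegral_mono_ae' hA ?_
    filter_upwards [hdens] with V hV hVA
    rw [← ENNReal.ofReal_mul hc]
    refine ENNReal.ofReal_le_ofReal ?_
    have h := hV (hAD hVA)
    calc (partitionFn (G := ↥(Matrix.specialUnitaryGroup (Fin 2) ℂ)) (F.P K) ((F.scheme ℰp γ).β K))⁻¹ * heightDensity F γ hjK ES V
        ≤ (partitionFn (G := ↥(Matrix.specialUnitaryGroup (Fin 2) ℂ)) (F.P K) ((F.scheme ℰp γ).β K))⁻¹ * (c * heightDensity F γ hjK E₁ V) :=
          mul_le_mul_of_nonneg_left h (inv_nonneg.mpr hZ.le)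
      _ = c * ((partitionFn (G := ↥(Matrix.specialUnitaryGroup (Fin 2) ℂ)) (F.P K) ((F.scheme ℰp γ).β K))⁻¹ * heightDensity F γ hjK E₁ V) := by ring

end Runs

/-! ## §3 The composition: `hdomBG_j` from the letters on print's restricted renormalised densities -/

section Compose

variable (F : T3Family) {γ : ℝ} (hγ : 0 ≤ γ)
  (ν : ℕ → (j : ℕ) → Measure (GaugeField (F.P j) 0 ↥(Matrix.specialUnitaryGroup (Fin 2) ℂ)))
  {K Ts : ℕ}
  (μ : (j : ℕ) → Measure (GaugeField (F.P j) 0 ↥(Matrix.specialUnitaryGroup (Fin 2) ℂ)))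
  (χ : (i : ℕ) → GaugeField (F.P i) 0 ↥(Matrix.specialUnitaryGroup (Fin 2) ℂ) → ℝ)
  (D Tg Sp : (i : ℕ) → Set (GaugeField (F.P i) 0 ↥(Matrix.specialUnitaryGroup (Fin 2) ℂ)))
  -- S1aᴴ's run system and a cut tower with MEASURABLE real weights `χ` (the door's text)
  (hν1 : ∀ K, ν K K = T4GenFunBounds.gibbsMeasure (F.P K) ((F.scheme ℰp γ).β K))
  (hν2 : ∀ K j, j < K → ν K j = Measure.map (descend F ℰp j) (ν K (j + 1)))
  (hTs : Ts ≤ K) (hχm : ∀ i, Measurable (χ i)) (hχ1 : ∀ i U, χ i U ≤ 1)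
  (hanch : ∀ j, Ts ≤ j → μ j = ν K j)
  (hcut : ∀ j, j < Ts → μ j = Measure.map (descend F ℰp j) ((μ (j + 1)).withDensity fun U => ENNReal.ofReal (χ (j + 1) U)))
  -- the supplier's measurable plateau targets (weight `= 1`) and support windows (weight `≤ 0` outside) at the cut heights `(j, Ts]`
  {j : ℕ} (hjK : j ≤ K) (hTgm : ∀ i, MeasurableSet (Tg i)) (hSpm : ∀ i, MeasurableSet (Sp i))
  (hplat : ∀ (i : ℕ), j < i → i ≤ Ts → ∀ U ∈ Tg i, χ i U = 1)
  (hsupp : ∀ (i : ℕ), j < i → i ≤ Ts → ∀ U, U ∉ Sp i → χ i U ≤ 0)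

include hγ hν1 hν2 hTs hχm hχ1 hanch hcut hjK hTgm hSpm hplat hsupp

/-- ★★★ **TOWER VERSION: `ν K j (A) ≤ e^{Σ_{i∈[j,Ts)} ω_i} · μ j (A)` FROM THE RESTRICTED-DENSITY LETTERS.**  The run system, ANY tower anchored at `Ts` and cut by measurable real
weights `χ ≤ 1` that equal `1` on the plateau targets `Tg_i` and are `≤ 0` off the support windows `Sp_i` (the line's `sfCut θ_i`: `Tg_i = {PlaqSmall (θ_i∕2)}`-type plateau,
`Sp_i = {PlaqSmall (24θ_i∕25)}` window), and per nonempty history `S ⊆ [j, Ts)` the letter «`ρ^{E_S}_{K−j} ≤ (Π_{i∈S} ω_i)·ρ^{E₁}_{K−j}` a.e. on `D_j`» ⟹ the run is dominated by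
the cut tower on every measurable `A ⊆ D_j` (§2 ∘ ✓`…S1aDomBGOfHistoryLetters.run_le_exp_mul_cutTower_of_historyLetters` at the canonical weights). Nothing of Bałaban's asserted;
the density letters are HYPOTHESES. [cite: Balaban1985UV3, (7) p.257, (41) p.266 and (47) p.267] -/
theorem run_le_exp_mul_cutTower_of_heightDensityLetters
    -- THE LETTERS IN PRINT's CURRENCY: per nonempty history `S ⊆ [j, Ts)`, a.e. on the good data, restricted density of the history ≤ `Π ω` × all-small restricted density
    (ω : ℕ → ℝ) (hω : ∀ i, 0 ≤ ω i)
    (hdens : ∀ S ∈ (Finset.Ico j Ts).powerset, S.Nonempty →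
      ∀ᵐ V ∂(fieldMeasure (F.P j) 0 ↥(Matrix.specialUnitaryGroup (Fin 2) ℂ)), V ∈ D j →
        heightDensity F γ hjK {U : GaugeField (F.P K) 0 ↥(Matrix.specialUnitaryGroup (Fin 2) ℂ) |
            (∀ i ∈ S, ∀ (h : i + 1 ≤ K), descendTo F ℰp (i + 1) K h U ∉ Tg (i + 1)) ∧
            (∀ i ∈ Finset.Ico j Ts, i ∉ S → ∀ (h : i + 1 ≤ K), descendTo F ℰp (i + 1) K h U ∈ Sp (i + 1))} V ≤
          (∏ i ∈ S, ω i) * heightDensity F γ hjK {U : GaugeField (F.P K) 0 ↥(Matrix.specialUnitaryGroup (Fin 2) ℂ) |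
            ∀ i ∈ Finset.Ico j Ts, ∀ (h : i + 1 ≤ K), descendTo F ℰp (i + 1) K h U ∈ Tg (i + 1)} V)
    {A : Set (GaugeField (F.P j) 0 ↥(Matrix.specialUnitaryGroup (Fin 2) ℂ))} (hA : MeasurableSet A) (hAD : A ⊆ D j) :
    ν K j A ≤ ENNReal.ofReal (Real.exp (∑ i ∈ Finset.Ico j Ts, ω i)) * μ j A := by
  obtain ⟨hwm, hw1, hw⟩ :=
    FluctuationComparisonRegPrIntLS1aDomBGOfHistoryLetters.canonicalWeight_spec F (K := K) (Ts := Ts) hTs χ hχm hχ1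
  refine run_le_exp_mul_cutTower_of_historyLetters F ν μ χ
    (fun i U => if h : i + 1 ≤ K then ENNReal.ofReal (χ (i + 1) (descendTo F ℰp (i + 1) K h U)) else 1) D
    hν1 hν2 hTs hχm hanch hcut hjK hwm hw1 (hw j) ω hω ?_ hA hAD
  intro A hA hAD S hS hSne
  have hSsub : S ⊆ Finset.Ico j Ts := Finset.mem_powerset.mp hS
  refine historyLetter_of_heightDensityLetter F hTs hjK Tg Sp hTgm hSpm hγ S hSsub hw1 ?_ ?_
    (Finset.prod_nonneg fun i _ => hω i) (hdens S hS hSne) hA hAD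
  · -- on the plateau the canonical weight is one
    intro i hi h U hU
    have hi' := Finset.mem_Ico.mp hi
    simp only [h, dif_pos, hplat (i + 1) (by omega) (by omega) _ hU, ENNReal.ofReal_one]
  · -- a non-zero canonical weight forces the support window
    intro i hi h U hne
    have hi' := Finset.mem_Ico.mp hi
    by_contra hU
    refine hne ?_
    simp only [h, dif_pos]
    exact ENNReal.ofReal_eq_zero.mpr (hsupp (i + 1) (by omega) (by omega) _ hU)

/-- ★★★ **THE `hdomBG_j` BINDER OF THE TOWER DOOR OF RECORD (✓`…S1aAlphaPhiMTowerBG` l.86–90) FROM THE LETTERS ON PRINT's RESTRICTED RENORMALISED DENSITIES.**  In the door's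
scope (run system, `K`, `Ts ≤ K`, a tower cut by measurable real weights `χ ≤ 1` with plateau targets `Tg` and support windows `Sp`, a height `j ≤ K`, continuous densities
`ρᶜ ≥ 0` of `μ j` and `ρᵗ` of `ν K j`): if the supplier's domain `D_j` is OPEN and contains (read back through `fieldShift`) the (E)-good data of v19 «BACKGROUND WINDOWS», and
for every nonempty history `S ⊆ [j, Ts)` of cut steps «`ρ^{E_S}_{K−j}(V) ≤ (Π_{i∈S} ω_i) · ρ^{E₁}_{K−j}(V)` for `dU_j`-a.e. `V ∈ D_j`» with `Σ_{i∈[j,Ts)} ω_i ≤ Δ`, THEN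
`readAtLevel ρᵗ V ≤ e^{Δ} · readAtLevel ρᶜ V` at every such datum: the letter `hdomBG_j` VERBATIM (`θ := θBal F.L γ b₀ p₀ j`, `Δ := Δ j`).  ★p1's residual for the (m)_E cut heights
in PRINT's CURRENCY: (41)'s history terms against its all-small term, pointwise in the bottom datum.  Nothing of Bałaban's asserted; the letters, `D_j`, `Tg`, `Sp` and `hgood`
are the supplier's. [cite: Balaban1985UV3, (41) p.266, (47) p.267 and pp.273–274] -/
theorem hdomBG_of_heightDensityLetters
    -- THE LETTERS IN PRINT's CURRENCY: per nonempty history `S ⊆ [j, Ts)`, a.e. on the good data, restricted density of the history ≤ `Π ω` × all-small restricted density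
    (ω : ℕ → ℝ) (hω : ∀ i, 0 ≤ ω i)
    (hdens : ∀ S ∈ (Finset.Ico j Ts).powerset, S.Nonempty →
      ∀ᵐ V ∂(fieldMeasure (F.P j) 0 ↥(Matrix.specialUnitaryGroup (Fin 2) ℂ)), V ∈ D j →
        heightDensity F γ hjK {U : GaugeField (F.P K) 0 ↥(Matrix.specialUnitaryGroup (Fin 2) ℂ) |
            (∀ i ∈ S, ∀ (h : i + 1 ≤ K), descendTo F ℰp (i + 1) K h U ∉ Tg (i + 1)) ∧
            (∀ i ∈ Finset.Ico j Ts, i ∉ S → ∀ (h : i + 1 ≤ K), descendTo F ℰp (i + 1) K h U ∈ Sp (i + 1))} V ≤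
          (∏ i ∈ S, ω i) * heightDensity F γ hjK {U : GaugeField (F.P K) 0 ↥(Matrix.specialUnitaryGroup (Fin 2) ℂ) |
            ∀ i ∈ Finset.Ico j Ts, ∀ (h : i + 1 ≤ K), descendTo F ℰp (i + 1) K h U ∈ Tg (i + 1)} V)
    (hDo : IsOpen (D j)) {Δ : ℝ} (hΔ : ∑ i ∈ Finset.Ico j Ts, ω i ≤ Δ)
    (ρc ρt : GaugeField (F.P j) 0 ↥(Matrix.specialUnitaryGroup (Fin 2) ℂ) → ℝ) (hcc : Continuous ρc) (htc : Continuous ρt) (hc0 : ∀ V, 0 ≤ ρc V)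
    (hμc : μ j = (fieldMeasure (F.P j) 0 ↥(Matrix.specialUnitaryGroup (Fin 2) ℂ)).withDensity fun V => ENNReal.ofReal (ρc V))
    (hνt : ν K j = (fieldMeasure (F.P j) 0 ↥(Matrix.specialUnitaryGroup (Fin 2) ℂ)).withDensity fun V => ENNReal.ofReal (ρt V))
    {θ R₀ : ℝ}
    (hgood : ∀ V : GaugeField (F.P K) (K - j) ↥(Matrix.specialUnitaryGroup (Fin 2) ℂ), PlaqSmall θ V →
      (∃ U₀ : GaugeField (F.P K) 0 ↥(Matrix.specialUnitaryGroup (Fin 2) ℂ),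
          IsBackground (fun i => BlockAveraging.blockAvg (P := F.P K) (j := i) ℰp) {U | PlaqSmall R₀ U} (K - j) V U₀ ∧
          PlaqSmall (θ * ((F.L : ℝ)⁻¹) ^ (2 * (K - j))) U₀) →
      fieldShift (heightShift_eq F hjK) V ∈ D j) :
    ∀ V : GaugeField (F.P K) (K - j) ↥(Matrix.specialUnitaryGroup (Fin 2) ℂ), PlaqSmall θ V →
      (∃ U₀ : GaugeField (F.P K) 0 ↥(Matrix.specialUnitaryGroup (Fin 2) ℂ),
          IsBackground (fun i => BlockAveraging.blockAvg (P := F.P K) (j := i) ℰp) {U | PlaqSmall R₀ U} (K - j) V U₀ ∧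
          PlaqSmall (θ * ((F.L : ℝ)⁻¹) ^ (2 * (K - j))) U₀) →
      readAtLevel F hjK ρt V ≤ Real.exp Δ * readAtLevel F hjK ρc V := by
  obtain ⟨hwm, hw1, hw⟩ :=
    FluctuationComparisonRegPrIntLS1aDomBGOfHistoryLetters.canonicalWeight_spec F (K := K) (Ts := Ts) hTs χ hχm hχ1
  refine hdomBG_of_historyLetters F ν μ χ
    (fun i U => if h : i + 1 ≤ K then ENNReal.ofReal (χ (i + 1) (descendTo F ℰp (i + 1) K h U)) else 1) D
    hν1 hν2 hTs hχm hanch hcut hjK hwm hw1 (hw j) ω hω ?_ hDo hΔ ρc ρt hcc htc hc0 hμc hνt hgood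
  intro A hA hAD S hS hSne
  have hSsub : S ⊆ Finset.Ico j Ts := Finset.mem_powerset.mp hS
  refine historyLetter_of_heightDensityLetter F hTs hjK Tg Sp hTgm hSpm hγ S hSsub hw1 ?_ ?_
    (Finset.prod_nonneg fun i _ => hω i) (hdens S hS hSne) hA hAD
  · intro i hi h U hU
    have hi' := Finset.mem_Ico.mp hi
    simp only [h, dif_pos, hplat (i + 1) (by omega) (by omega) _ hU, ENNReal.ofReal_one]
  · intro i hi h U hne
    have hi' := Finset.mem_Ico.mp hi
    by_contra hU
    refine hne ?_
    simp only [h, dif_pos]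
    exact ENNReal.ofReal_eq_zero.mpr (hsupp (i + 1) (by omega) (by omega) _ hU)

end Compose

/-! ## §4 The line's `sfCut` meets the plateau∕support shape (consumer's one-liners, stated for ANY product-of-ramps weight) -/

section Ramp

/-- A clipped ramp `max 0 (min 1 t)` equals `1` as soon as `t ≥ 1` and is `≤ 0` as soon as `t ≤ 0`; hence a finite product of such ramps is `1` when every argument is `≥ 1`
and `≤ 0` when one argument is `≤ 0` — the plateau (`hplat`) and support (`hsupp`) clauses of §3 for any `sfCut`-shaped weight. [folklore] -/
theorem prod_ramp_eq_one_of_forall_one_le {ι : Type*} (s : Finset ι) {t : ι → ℝ} (h : ∀ p ∈ s, 1 ≤ t p) :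
    ∏ p ∈ s, max 0 (min 1 (t p)) = 1 :=
  Finset.prod_eq_one fun p hp => by rw [min_eq_left (h p hp), max_eq_right zero_le_one]

/-- Companion: one argument `≤ 0` kills the product of ramps (it is then `≤ 0`, indeed `= 0`). [folklore] -/
theorem prod_ramp_nonpos_of_exists_nonpos {ι : Type*} (s : Finset ι) {t : ι → ℝ} (h : ∃ p ∈ s, t p ≤ 0) :
    ∏ p ∈ s, max 0 (min 1 (t p)) ≤ 0 := by
  obtain ⟨p, hp, htp⟩ := h
  rw [Finset.prod_eq_zero hp (by rw [max_eq_left (le_trans (min_le_right _ _) htp)])]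

end Ramp

end Summit.QuantumFields.YangMills.Theorems.FluctuationComparisonRegPrIntLS1aHistoryLettersOfRestrictedDensities

end
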